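/-
Copyright (c) 2026. All rights reserved.
Released under Apache 2.0 license as described in the file LICENSE.
-/
import Literature.AlgebraicGeometry.ComplexMultiplication.HyperellipticJacobianStablyNondegenerateLevels
import Literature.AlgebraicGeometry.HodgeTheory.TimesGenericStablyNondegenerateProductSpan
import HarnessLib

/-!
# `J_{4p}` is stably DEGENERATE for every prime `p ≥ 7`: `rank MT(J_{4p}) = p < p + 1 = rdim J_{4p} + 1`, so some product of the
# CM pieces `X_4, X_p, X_{4p}` of `J(y² = x^{4p} − 1)` carries an exceptional Hodge class (GGL 2024 Thm. 3.0; Gordon 7.5 (1) ⟹ (3))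

Layer `Literature/AlgebraicGeometry/ComplexMultiplication`, namespace `…ComplexMultiplication.HyperellipticJacobian`; the first EVEN entry of
the negative half of the classification begun in `HyperellipticJacobianStablyNondegenerateLevels` (F35: `J_m` is stably nondegenerate for
`m ∈ {p, 2p, 2^k, 3, 4, 6, 8, 12, 24, 20}`; for odd composite `m` and odd prime powers the tree's `HyperellipticJacobianExceptionalClasses` has
the exceptional classes).  THEOREMS ONLY (no definition, no named fact, no `sorry`, no instance).

THE PRINT.  Gallese–Goodson–Lombardo [GalleseGoodsonLombardo2024] (held `paper:arxiv-2405.20394`): §1 p. 4 «It can be shown that in most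
cases the Hodge ring of `J_m` contains exceptional Hodge cycles (see [Shioda3] and [Heidi])»; §3 Thm. 3.0 (p. 12) `J_{4p} ∼ X_4 × X_p × X_{2p}
× X_{4p}`, (3)–(5): `X_p` simple with CM by `ℚ(ζ_p)`, `X_{2p} ∼ X_p`, `X_{4p} ∼ Y_{4p}²` with `Y_{4p}` simple of dimension `φ(4p)/4 =
(p−1)/2` and CM by `ℚ(ζ_{4p} − ζ_{4p}^{−1})`; last statement: the `X_d` at odd and at `4 ∣ d` levels are not isogenous (tree
`orthogonal_odd_fourDvd`).  Gordon [Gordon1999HodgeAVSurvey] 7.4–7.5 (Murty, Hazama): `A ∼ ∏ A_i^{m_i}` with the `A_i` simple, pairwise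
non-isogenous is stably nondegenerate iff `rank Hg(A)_ℂ = rdim A = Σ_i rdim A_i`; 7.6.1.  HERE: `rdim J_{4p} = dim X_4 + dim X_p + dim Y_{4p}
= 1 + (p−1)/2 + (p−1)/2 = p`, while `rank MT(J_{4p}) = rank MT(X_4 × X_p × X_{4p}) = 1 + φ(4p)/2 = p` (Kubota's Lemma 2 on the conductor
levels `4, p, 4p`, F34's `cmFamilyRank_eq_one_add_totient_div_two_of_conductorLevels`) — ONE SHORT of `rdim + 1`.

WHAT IS PROVED (on the `J_{4p}`-family: one realisation `C_j ⊨ (ℚ(ζ_{e_j}); Ψ_j)` of the lower-half type at each divisor `e ≥ 3` of `4p`,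
levels injective; `p ≥ 7` prime, so `4p ∉ {20, 24, 60}`).
* `cmFamilyRank_eq_of_levels_fourMulPrime` — `rank MT(X_4 × X_p × X_{4p}) = p` for any family at levels dividing `4p` containing `4, p, 4p`.
* `exists_subpair_simpleIsogenyFactor` (one piece: Shimura Thm. 3 ∕ Prop. 26 via the tree's `exists_isIsogeny_power_simple_cyclotomic`) and
  **`exists_subpairs_of_levels_fourMulPrime`** — the members of levels `4, p, 4p` carry sub-pairs `(K₁, Φ₁)` inducing their types, realised by
  SIMPLE, PAIRWISE NON-ISOGENOUS `B_t` (the CM data of `X_4`, `X_p`, `Y_{4p}`: dimensions `1, (p−1)/2, (p−1)/2`; `X_p ⟂ X_{4p}`) with `Σ dim B_t =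
  p = rank`.
* **`exists_exceptional_prod_fourMulPrime`** — THERE ARE `N`, `π : Fin N → κ`, `q` AND A RATIONAL `(q,q)`-CLASS ON `⨁_{k<N} C_{π k}` OUTSIDE
  `𝓓^q ⊗ ℂ`: some product of the CM pieces of `J_{4p}` has Hodge ring NOT generated by divisor classes (Gordon 7.5 (1) ⟹ (3) for separating
  families, tree `exists_exceptional_prod_of_not_isNondegenerateFamily_inducedCMType`); **`not_isStablyNondegenerate_of_levels_fourMulPrime`** —
  the product `X_4 × X_p × X_{4p}` of the three members is NOT stably nondegenerate (tree
  `isStablyNondegenerate_biproduct_iff_cmFamilyRank_eq_sum_dim_inducedCMType`).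

* §4 WITHOUT the divisibility hypothesis: any family with members of levels `4, p, 4p` (`p ≥ 7` prime) — in particular the `J_m`-family for
  EVERY `m` with `4p ∣ m` (`m = 28, 44, 52, 56, 76, 84, 88, …`) — has a product of members with an exceptional Hodge class
  (`exists_exceptional_prod_of_levels_fourMulPrime`, **`exists_exceptional_prod_of_fourMulPrime_dvd`**; primed forms of the §3 statements).

* §5 `J_m` ITSELF: for every `m` with `4p ∣ m` (`p ≥ 7` prime) the biproduct `⨁_j C_j` of the Thm.-3.0 decomposition, and everything isogenous
  to it, is NOT stably nondegenerate (`not_isStablyNondegenerate_biproduct_of_levels_fourMulPrime`,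
  **`not_isStablyNondegenerate_of_isIsogenous_biproduct_of_fourMulPrime_dvd`**; the sub-biproduct `X_4 ⊕ X_p ⊕ X_{4p}` is a retract, Hazama's
  remark in Gordon 7.6.1 via the tree's `IsStablyNondegenerate.of_comp_eq_nsmul_id`).

HONEST REGISTER.  This does NOT exhibit the class, its codimension, or decide the Hodge conjecture for these products (an exceptional Hodge
class is one outside the span of products of divisor classes; its algebraicity is the open question, untouched here); «`J_{4p}`» is the
abstract biproduct (Thm. 3.0 read as hypothesis); §5 gives the statement for the full biproduct
`J_m` itself (not stably nondegenerate), without locating the power or the codimension.  The sentence «`J_{4p}` is degenerate» is ASSEMBLED (rank vs reduced dimension); GGL print «in most cases … exceptional Hodge cycles».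
-/

noncomputable section

open CategoryTheory CategoryTheory.Limits NumberField Module

namespace Literature.AlgebraicGeometry.ComplexMultiplication

open Literature.AlgebraicGeometry.Motives
open Literature.AlgebraicGeometry.Motives.AbelianVariety
open Literature.AlgebraicGeometry.Milne1999
open Literature.AlgebraicGeometry.HodgeTheory (complexBetti HodgeConjectureFor IsRationalClass IsOfHodgeType IsStablyNondegenerate)
open Literature.AlgebraicGeometry.VanGeemen1994 (hodgeClassSpan)
open Literature.Barriers.HodgeConjecture (divisorClassesSpan)
open Literature.NumberTheory.ComplexMultiplication

namespace HyperellipticJacobian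

open Literature.AlgebraicGeometry.Pohlmann1968 Literature.AlgebraicGeometry.Pohlmann1968.Cyclotomic
open Literature.AlgebraicGeometry.Pohlmann1968.CMAlgebra
open CyclotomicCMTypeResidueSets (unitResidues residueSet)

/-! ## §1 Arithmetic of the level `4p` and the rank `p` -/

section Rank

/-- The divisors of `4p` (`p` an odd prime): `1, 2, 4, p, 2p, 4p`. [folklore] -/
private theorem eq_of_dvd_four_mul_prime {p d : ℕ} (hp : p.Prime) (hd : d ∣ 4 * p) :
    d = 1 ∨ d = 2 ∨ d = 4 ∨ d = p ∨ d = 2 * p ∨ d = 4 * p := by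
  obtain ⟨d₁, d₂, h₁, h₂, rfl⟩ := Nat.dvd_mul.1 hd
  have hmem : d₁ ∈ Nat.divisors 4 := Nat.mem_divisors.2 ⟨h₁, by norm_num⟩
  have key : ∀ e ∈ Nat.divisors 4, e = 1 ∨ e = 2 ∨ e = 4 := by decide
  rcases key d₁ hmem with rfl | rfl | rfl <;> rcases (Nat.dvd_prime hp).1 h₂ with rfl | rfl <;> omega

/-- `φ(4p) = 2(p − 1)` for an odd prime `p`. [folklore] -/
private theorem totient_four_mul_prime {p : ℕ} (hp : p.Prime) (hp2 : p ≠ 2) : (4 * p).totient = 2 * (p - 1) := by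
  have hcop : Nat.Coprime 4 p := by
    have h := (Nat.coprime_two_left.2 (hp.odd_of_ne_two hp2)).pow_left 2
    norm_num at h
    exact h
  rw [Nat.totient_mul hcop, Nat.totient_prime hp, show Nat.totient 4 = 2 by decide]

variable {I : Type} [Fintype I] [Nonempty I] {lev : I → ℕ} [∀ i, NeZero (lev i)] {K : I → Type} [∀ i, Field (K i)]
  [∀ i, NumberField (K i)] [∀ i, IsCyclotomicExtension {lev i} ℚ (K i)]

/-- **`rank MT(J_{4p}) = rank MT(X_4 × X_p × X_{4p}) = p`** (`p` an odd prime): any family of lower-half types at levels dividing `4p` among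
which `4, p, 4p` occur has rank `1 + φ(4p)/2 = p` — the conductor levels are `4, p, 4p` (`2p ≡ 2 (mod 4)` is not one).
[cite: GalleseGoodsonLombardo2024, §3 Thm. 3.0 and §4.1 Prop. 19] [cite: Kubota1965, §4 Lemma 2] -/
theorem cmFamilyRank_eq_of_levels_fourMulPrime {p : ℕ} (hp : p.Prime) (hp2 : p ≠ 2) (hdvd : ∀ i, lev i ∣ 4 * p)
    (h₄ : ∃ i, lev i = 4) (hP : ∃ i, lev i = p) (h₄P : ∃ i, lev i = 4 * p) (Φ : ∀ i, CMType (K i))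
    (hΦ : ∀ i (σ : K i →+* ℂ), σ ∈ (Φ i).1 ↔ 2 * (expOf (lev i) (K i) σ).val < lev i) : cmFamilyRank Φ = p := by
  have hp3 : 3 ≤ p := by have := hp.two_le; omega
  rw [cmFamilyRank_eq_one_add_totient_div_two_of_conductorLevels (N := 4 * p) (by omega) hdvd (fun d hd hd3 hd2 => ?_) Φ hΦ,
    totient_four_mul_prime hp hp2]
  · omega
  · have hpodd : p % 2 = 1 := Nat.odd_iff.1 (hp.odd_of_ne_two hp2)
    rcases eq_of_dvd_four_mul_prime hp hd with rfl | rfl | rfl | rfl | rfl | rfl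
    · omega
    · omega
    · exact h₄
    · exact hP
    · exfalso; omega
    · exact h₄P

end Rank

/-! ## §2 The CM data of one piece: primitive sub-pair, simple factor, simple isogeny factor -/

section Piece

variable {N : ℕ} [NeZero N] {K : Type} [Field K] [NumberField K] [IsCyclotomicExtension {N} ℚ K] {Φ : CMType K}
  {A : AbelianVariety ℂ} {ι : 𝓞 K →+* End A} {θ : K →+* Module.End ℂ (complexBetti A.X 1)}

/-- **Shimura §6.2 Thm. 3 ∕ §8.2 Prop. 26 for one piece `X_N`**: a realisation `A` of a CM type `Φ` of `ℚ(ζ_N)` (`N ≥ 3`) determines a CM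
sub-pair `(K₁, Φ₁)` with `Φ₁^K = Φ` and a SIMPLE realisation `B ⊨ (K₁; Φ₁)` that is a simple isogeny factor of `A` (`A ∼ B^{|W|}`; the tree's
`exists_isIsogeny_power_simple_cyclotomic`). [cite: Shimura1998, §6.2 Thm. 3 and §8.2 Prop. 26] [cite: KoblitzRohrlich1978, §1 p. 1184] -/
theorem exists_subpair_simpleIsogenyFactor (h2 : 2 < N) (hA : IsCMTypeRealisation Φ A ι θ) :
    ∃ (K₁ : IntermediateField ℚ K) (Φ₁ : CMType K₁) (B : AbelianVariety ℂ) (ιB : 𝓞 K₁ →+* End B)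
      (θB : K₁ →+* Module.End ℂ (complexBetti B.X 1)), IsCMField K₁ ∧ inducedCMType (algebraMap K₁ K) Φ₁ = Φ ∧
      IsCMTypeRealisation Φ₁ B ιB θB ∧ B.IsSimple ∧ IsSimpleIsogenyFactor B A := by
  haveI : IsCMField K := IsCyclotomicExtension.Rat.isCMField K (S := {N}) ⟨N, rfl, h2⟩
  obtain ⟨K₁, Φ₁, hCM, h₁, -, -, B, ιB, θB, hB, hs, hdim, P, π, hP, g, hg, -⟩ :=
    exists_isIsogeny_power_simple_cyclotomic (N := N) hA
  have hφ : 0 < N.totient := Nat.totient_pos.2 (by omega)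
  have hprod : 0 < 2 * B.dim * ((unitResidues N).filter fun t =>
      ∀ c ∈ unitResidues N, (c * t ∈ residueSet N Φ ↔ c ∈ residueSet N Φ)).card := by
    rw [hdim]; exact hφ
  have h0 : 0 < B.dim := by
    rcases Nat.eq_zero_or_pos B.dim with h | h
    · rw [h] at hprod; simp at hprod
    · exact h
  have hW : 0 < ((unitResidues N).filter fun t =>
      ∀ c ∈ unitResidues N, (c * t ∈ residueSet N Φ ↔ c ∈ residueSet N Φ)).card := by
    rcases Nat.eq_zero_or_pos ((unitResidues N).filter fun t =>
      ∀ c ∈ unitResidues N, (c * t ∈ residueSet N Φ ↔ c ∈ residueSet N Φ)).card with h | h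
    · rw [h] at hprod; simp at hprod
    · exact h
  exact ⟨K₁, Φ₁, B, ιB, θB, hCM, h₁, hB, hs, isSimpleIsogenyFactor_of_isLimit_fan hP hg hs h0 hW⟩

end Piece

/-! ## §3 `J_{4p}`, `p ≥ 7`: the descended family of `X_4, X_p, X_{4p}` is separating but NOT nondegenerate; an exceptional class -/

section Family

variable {κ : Type} {lev : κ → ℕ} [∀ j, NeZero (lev j)] {F : κ → Type} [∀ j, Field (F j)]
  [∀ j, NumberField (F j)] [∀ j, IsCyclotomicExtension {lev j} ℚ (F j)] {Ψ : ∀ j, CMType (F j)} {C : κ → AbelianVariety ℂ}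
  {ιC : ∀ j, 𝓞 (F j) →+* End (C j)} {θC : ∀ j, F j →+* Module.End ℂ (complexBetti (C j).X 1)}

/-- THE CORE (three members of levels `4, p, 4p`, `p ≥ 7` prime): CM sub-pairs `(K₁ t, Φ₁ t)` inducing the types, realised by SIMPLE,
PAIRWISE NON-ISOGENOUS `B t` (the CM data of `X_4`, `X_p`, `Y_{4p}`: dimensions `1, (p−1)/2, (p−1)/2`; `X_p ⟂ X_{4p}`), with
`Σ_t dim B_t = p = rank MT(X_4 × X_p × X_{4p})`. [cite: GalleseGoodsonLombardo2024, §3 Thm. 3.0 (3)–(5) and its last statement]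
[cite: Shimura1998, §6.2 Thm. 3 and §8.2 Prop. 26] [cite: Kubota1965, §4 Lemma 2] -/
theorem exists_subpairs_of_levels_fourMulPrime {p : ℕ} (hp : p.Prime) (hp7 : 7 ≤ p) (hdvd : ∀ j, lev j ∣ 4 * p)
    (hΨ : ∀ j (σ : F j →+* ℂ), σ ∈ (Ψ j).1 ↔ 2 * (expOf (lev j) (F j) σ).val < lev j)
    (hC : ∀ j, IsCMTypeRealisation (Ψ j) (C j) (ιC j) (θC j)) {v : Fin 3 → κ} (hv0 : lev (v 0) = 4) (hv1 : lev (v 1) = p)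
    (hv2 : lev (v 2) = 4 * p) :
    ∃ (K₁ : ∀ t : Fin 3, IntermediateField ℚ (F (v t))) (Φ₁ : ∀ t, CMType (K₁ t)) (B : Fin 3 → AbelianVariety ℂ)
      (ιB : ∀ t, 𝓞 (K₁ t) →+* End (B t)) (θB : ∀ t, K₁ t →+* Module.End ℂ (complexBetti (B t).X 1)),
      (∀ t, IsCMField (K₁ t)) ∧ (∀ t, inducedCMType (algebraMap (K₁ t) (F (v t))) (Φ₁ t) = Ψ (v t)) ∧
      (∀ t, IsCMTypeRealisation (Φ₁ t) (B t) (ιB t) (θB t)) ∧ (∀ t, (B t).IsSimple) ∧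
      (∀ t t', t ≠ t' → ¬IsIsogenous (B t) (B t')) ∧ (∑ t, (B t).dim) = p ∧ cmFamilyRank (fun t : Fin 3 => Ψ (v t)) = p := by
  classical
  have hp2 : p ≠ 2 := by omega
  have hp15 : p ≠ 15 := by rintro rfl; exact absurd hp (by decide)
  have hpodd : Odd p := hp.odd_of_ne_two hp2
  have h2 : ∀ t : Fin 3, 2 < lev (v t) := fun t => by
    fin_cases t
    · show 2 < lev (v 0); omega
    · show 2 < lev (v 1); omega
    · show 2 < lev (v 2); omega
  -- §2 on the three members: sub-pairs and simple isogeny factors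
  choose K₁ Φ₁ B ιB θB hCM hind hB hs hISF using fun t : Fin 3 => exists_subpair_simpleIsogenyFactor (h2 t) (hC (v t))
  -- dimensions `1, (p−1)/2, (p−1)/2`
  have hd0 : (B 0).dim = 1 := by
    have hA := (hC (v 0)).two_mul_dim_eq_totient (h2 0)
    rw [hv0, show Nat.totient 4 = 2 by decide] at hA
    have hle := (hISF 0).dim_le
    have hpos := (hISF 0).dim_pos
    omega
  have hBA1 : IsIsogenous (B 1) (C (v 1)) ∧ 2 * (B 1).dim = p - 1 := by
    have h := two_mul_dim_eq_totient_of_isSimpleIsogenyFactor_of_not_four_dvd (N := lev (v 1)) (by rw [hv1]; omega)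
      (by rw [hv1]; intro h4; exact hpodd.not_two_dvd_nat (dvd_trans ⟨2, rfl⟩ h4)) (hΨ (v 1)) (hC (v 1)) (hISF 1)
    rw [hv1, Nat.totient_prime hp] at h
    exact h
  have hd2 : 4 * (B 2).dim = 2 * (p - 1) := by
    have h := four_mul_dim_eq_totient_of_isSimpleIsogenyFactor_of_four_dvd (N := lev (v 2)) (by rw [hv2]; exact ⟨p, rfl⟩)
      (by rw [hv2]; omega) (by rw [hv2]; omega) (by rw [hv2]; omega) (by rw [hv2]; omega) (hΨ (v 2)) (hC (v 2)) (hISF 2)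
    rw [hv2, totient_four_mul_prime hp hp2] at h
    exact h
  -- pairwise non-isogeny: dimensions, and `X_p ⟂ X_{4p}`
  have h01 : ¬IsIsogenous (B 0) (B 1) := fun h => by have := h.dim_eq; omega
  have h02 : ¬IsIsogenous (B 0) (B 2) := fun h => by have := h.dim_eq; omega
  have h12 : ¬IsIsogenous (B 1) (B 2) := by
    obtain ⟨hzero, -, -, -⟩ := orthogonal_odd_fourDvd (d := lev (v 1)) (d' := lev (v 2)) (by rw [hv1]; exact hpodd)
      (by rw [hv1]; omega) (hΨ (v 1)) (hC (v 1)) (by rw [hv2]; exact ⟨p, rfl⟩) (by rw [hv2]; omega) (by rw [hv2]; omega)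
      (by rw [hv2]; omega) (by rw [hv2]; omega) (hΨ (v 2)) (hC (v 2))
    intro hiso
    obtain ⟨f, hf⟩ := (((hISF 2).of_isIsogenous_left hiso.symm').of_isIsogenous_left hBA1.1).exists_hom_ne_zero
    exact hf (hzero f)
  have hniso : ∀ t t' : Fin 3, t ≠ t' → ¬IsIsogenous (B t) (B t') := by
    intro t t' htt'
    fin_cases t <;> fin_cases t' <;>
      first
      | exact absurd rfl htt'
      | exact h01
      | exact h02
      | exact h12
      | exact fun h => h01 h.symm'
      | exact fun h => h02 h.symm'
      | exact fun h => h12 h.symm'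
  have hrank : cmFamilyRank (fun t : Fin 3 => Ψ (v t)) = p :=
    cmFamilyRank_eq_of_levels_fourMulPrime (lev := fun t => lev (v t)) (K := fun t => F (v t)) hp hp2
      (fun t => hdvd (v t)) ⟨0, hv0⟩ ⟨1, hv1⟩ ⟨2, hv2⟩ (fun t => Ψ (v t)) fun t σ => hΨ (v t) σ
  refine ⟨K₁, Φ₁, B, ιB, θB, hCM, hind, hB, hs, hniso, ?_, hrank⟩
  rw [Fin.sum_univ_three]
  have h1 := hBA1.2
  omega

/-- **`X_4 × X_p × X_{4p}` IS NOT STABLY NONDEGENERATE** (`p ≥ 7` prime; any three members of the `J_{4p}`-family of levels `4, p, 4p`):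
`rank MT = p ≠ p + 1 = rdim + 1` — Gordon 7.5 (1) ⟺ (3) for simple, pairwise non-isogenous CM factors (tree
`isStablyNondegenerate_biproduct_iff_cmFamilyRank_eq_sum_dim_inducedCMType`): some power of `X_4 × X_p × X_{4p}` has Hodge ring NOT generated by
divisor classes. [cite: GalleseGoodsonLombardo2024, §1 (p. 4) and §3 Thm. 3.0] [cite: Gordon1999HodgeAVSurvey, 7.4, 7.5 and 7.6.1] -/
theorem not_isStablyNondegenerate_of_levels_fourMulPrime {p : ℕ} (hp : p.Prime) (hp7 : 7 ≤ p) (hdvd : ∀ j, lev j ∣ 4 * p)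
    (hΨ : ∀ j (σ : F j →+* ℂ), σ ∈ (Ψ j).1 ↔ 2 * (expOf (lev j) (F j) σ).val < lev j)
    (hC : ∀ j, IsCMTypeRealisation (Ψ j) (C j) (ιC j) (θC j)) {v : Fin 3 → κ} (hv0 : lev (v 0) = 4) (hv1 : lev (v 1) = p)
    (hv2 : lev (v 2) = 4 * p) : ¬IsStablyNondegenerate (⨁ fun t : Fin 3 => C (v t)) := by
  classical
  have h2 : ∀ j, 2 < lev j → IsCMField (F j) := fun j hj =>
    IsCyclotomicExtension.Rat.isCMField (F j) (S := {lev j}) ⟨lev j, rfl, hj⟩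
  haveI : ∀ t : Fin 3, IsCMField (F (v t)) := fun t => by
    fin_cases t
    · exact h2 (v 0) (by omega)
    · exact h2 (v 1) (by omega)
    · exact h2 (v 2) (by omega)
  obtain ⟨K₁, Φ₁, B, ιB, θB, hCM, hind, hB, hs, hniso, hsum, hrank⟩ :=
    exists_subpairs_of_levels_fourMulPrime hp hp7 hdvd hΨ hC hv0 hv1 hv2
  haveI : ∀ t : Fin 3, IsCMField (K₁ t) := hCM
  rw [isStablyNondegenerate_biproduct_iff_cmFamilyRank_eq_sum_dim_inducedCMType hB hs hniso
    (fun t => algebraMap (K₁ t) (F (v t))) hind (fun t => hC (v t)), hrank, hsum]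
  omega

/-- **`J_{4p}` IS STABLY DEGENERATE (`p ≥ 7` prime): SOME PRODUCT OF ITS CM PIECES CARRIES AN EXCEPTIONAL HODGE CLASS.**  For realisations
`(C_j ⊨ (ℚ(ζ_{e_j}); Ψ_j))_j` of the lower-half types with exactly one member at each divisor `e ≥ 3` of `4p` (`J_{4p} ∼ X_4 × X_p × X_{2p} ×
X_{4p}`, read as hypothesis), there are `N`, `π : Fin N → κ`, `q` and a RATIONAL class of Hodge type `(q,q)` on `⨁_{k<N} C_{π k}` lying OUTSIDE
`𝓓^q ⊗ ℂ`, the `ℂ`-span of `q`-fold products of rational divisor classes.  PROOF: the members of levels `4, p, 4p` have simple isogeny factors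
`X_4` (dim `1`), `X_p` (dim `(p−1)/2`, Thm. 3.0 (3)), `Y_{4p}` (dim `φ(4p)/4 = (p−1)/2`, Thm. 3.0 (5)) realising sub-pairs of their types;
these are pairwise non-isogenous (dimensions; `X_p ⟂ X_{4p}`, Thm. 3.0's last statement, tree `orthogonal_odd_fourDvd`), so the descended
family is separating (tree `isSeparatingFamily_of_isSimple_of_pairwise_not_isIsogenous`) with `Σ [F_t : ℚ]/2 + 1 = p + 1`, while its rank is
`rank MT(X_4 × X_p × X_{4p}) = p` (§1); hence it is not nondegenerate, and Gordon 7.5 (1) ⟹ (3) (tree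
`exists_exceptional_prod_of_not_isNondegenerateFamily_inducedCMType`) yields the class.  Nothing is claimed about its algebraicity.
[cite: GalleseGoodsonLombardo2024, §1 (p. 4: «in most cases the Hodge ring of J_m contains exceptional Hodge cycles») and §3 Thm. 3.0 (3)–(5) with its last statement]
[cite: Gordon1999HodgeAVSurvey, 7.4, 7.5 and 7.6.1] [cite: Kubota1965, §4 Lemma 2] [cite: Shimura1998, §6.2 Thm. 3 and §8.2 Prop. 26] -/
theorem exists_exceptional_prod_fourMulPrime {p : ℕ} (hp : p.Prime) (hp7 : 7 ≤ p)
    (hlev : ∀ d, (∃ j, lev j = d) ↔ d ∣ 4 * p ∧ 3 ≤ d) (hΨ : ∀ j (σ : F j →+* ℂ), σ ∈ (Ψ j).1 ↔ 2 * (expOf (lev j) (F j) σ).val < lev j)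
    (hC : ∀ j, IsCMTypeRealisation (Ψ j) (C j) (ιC j) (θC j)) :
    ∃ (N : ℕ) (π : Fin N → κ) (q : ℕ) (c : complexBetti (⨁ fun k : Fin N => C (π k)).X (2 * q)),
      IsRationalClass c ∧ IsOfHodgeType (⨁ fun k : Fin N => C (π k)).dim (⨁ fun k : Fin N => C (π k)).X (2 * q) q q c ∧
      c ∉ divisorClassesSpan (⨁ fun k : Fin N => C (π k)).X (⨁ fun k : Fin N => C (π k)).dim q := by
  classical
  obtain ⟨j₄, hj₄⟩ := (hlev 4).2 ⟨Dvd.intro p rfl, by norm_num⟩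
  obtain ⟨jP, hjP⟩ := (hlev p).2 ⟨Dvd.intro_left 4 rfl, by omega⟩
  obtain ⟨j₄P, hj₄P⟩ := (hlev (4 * p)).2 ⟨dvd_rfl, by omega⟩
  let v : Fin 3 → κ := ![j₄, jP, j₄P]
  have hv0 : lev (v 0) = 4 := hj₄
  have hv1 : lev (v 1) = p := hjP
  have hv2 : lev (v 2) = 4 * p := hj₄P
  have h2 : ∀ j, 2 < lev j := fun j => by have := ((hlev (lev j)).1 ⟨j, rfl⟩).2; omega
  haveI : ∀ j, IsCMField (F j) := fun j =>
    IsCyclotomicExtension.Rat.isCMField (F j) (S := {lev j}) ⟨lev j, rfl, h2 j⟩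
  obtain ⟨K₁, Φ₁, B, ιB, θB, hCM, hind, hB, hs, hniso, hsum, hrank⟩ :=
    exists_subpairs_of_levels_fourMulPrime hp hp7 (fun j => ((hlev (lev j)).1 ⟨j, rfl⟩).1) hΨ hC hv0 hv1 hv2
  haveI : ∀ t : Fin 3, IsCMField (K₁ t) := hCM
  -- separating, of total degree `2p`, rank `p`: NOT nondegenerate
  have hsep : IsSeparatingFamily Φ₁ := isSeparatingFamily_of_isSimple_of_pairwise_not_isIsogenous hB hs hniso
  have hdeg : ∀ t, Module.finrank ℚ (K₁ t) = 2 * (B t).dim := fun t => finrank_eq_two_mul_dim_of_isCMTypeRealisation (hB t)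
  have hnot : ¬IsNondegenerateFamily Φ₁ := by
    rw [isNondegenerateFamily_iff_cmFamilyRank_inducedCMType (fun t => algebraMap (K₁ t) (F (v t))) Φ₁ hind, hrank,
      Finset.sum_congr rfl fun t _ => hdeg t, ← Finset.mul_sum, hsum]
    omega
  have hA' : ∀ t : Fin 3, IsCMTypeRealisation (inducedCMType (algebraMap (K₁ t) (F (v t))) (Φ₁ t)) (C (v t)) (ιC (v t)) (θC (v t)) :=
    fun t => by rw [hind t]; exact hC (v t)
  obtain ⟨N, π, q, c, hcQ, hcH, hcD⟩ :=
    exists_exceptional_prod_of_not_isNondegenerateFamily_inducedCMType (A := fun t : Fin 3 => C (v t)) hsep hnot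
      (fun t => algebraMap (K₁ t) (F (v t))) hA'
  exact ⟨N, fun k => v (π k), q, c, hcQ, hcH, hcD⟩

/-! ## §4 Beyond the level `4p`: every family containing members of levels `4, p, 4p` — in particular the `J_m`-family for every `m`
## divisible by `4p` — has a product of pieces with an exceptional Hodge class -/

/-- **The core without the divisibility hypothesis**: three members of levels `4, p, 4p` (`p ≥ 7` prime) of ANY family of realisations of
lower-half types carry sub-pairs realised by simple, pairwise non-isogenous `B_t` with `Σ dim B_t = p = rank` (§3 applied to the three-member
family itself, whose levels divide `4p`). [cite: GalleseGoodsonLombardo2024, §3 Thm. 3.0 (3)–(5) and its last statement]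
[cite: Shimura1998, §6.2 Thm. 3 and §8.2 Prop. 26] [cite: Kubota1965, §4 Lemma 2] -/
theorem exists_subpairs_of_levels_fourMulPrime' {p : ℕ} (hp : p.Prime) (hp7 : 7 ≤ p)
    (hΨ : ∀ j (σ : F j →+* ℂ), σ ∈ (Ψ j).1 ↔ 2 * (expOf (lev j) (F j) σ).val < lev j)
    (hC : ∀ j, IsCMTypeRealisation (Ψ j) (C j) (ιC j) (θC j)) {v : Fin 3 → κ} (hv0 : lev (v 0) = 4) (hv1 : lev (v 1) = p)
    (hv2 : lev (v 2) = 4 * p) :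
    ∃ (K₁ : ∀ t : Fin 3, IntermediateField ℚ (F (v t))) (Φ₁ : ∀ t, CMType (K₁ t)) (B : Fin 3 → AbelianVariety ℂ)
      (ιB : ∀ t, 𝓞 (K₁ t) →+* End (B t)) (θB : ∀ t, K₁ t →+* Module.End ℂ (complexBetti (B t).X 1)),
      (∀ t, IsCMField (K₁ t)) ∧ (∀ t, inducedCMType (algebraMap (K₁ t) (F (v t))) (Φ₁ t) = Ψ (v t)) ∧
      (∀ t, IsCMTypeRealisation (Φ₁ t) (B t) (ιB t) (θB t)) ∧ (∀ t, (B t).IsSimple) ∧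
      (∀ t t', t ≠ t' → ¬IsIsogenous (B t) (B t')) ∧ (∑ t, (B t).dim) = p ∧ cmFamilyRank (fun t : Fin 3 => Ψ (v t)) = p := by
  have hdvd : ∀ t : Fin 3, lev (v t) ∣ 4 * p := fun t => by
    fin_cases t
    · show lev (v 0) ∣ 4 * p; rw [hv0]; exact Dvd.intro p rfl
    · show lev (v 1) ∣ 4 * p; rw [hv1]; exact Dvd.intro_left 4 rfl
    · show lev (v 2) ∣ 4 * p; rw [hv2]
  exact exists_subpairs_of_levels_fourMulPrime (lev := fun t => lev (v t)) (F := fun t => F (v t)) (Ψ := fun t => Ψ (v t))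
    (C := fun t => C (v t)) (ιC := fun t => ιC (v t)) (θC := fun t => θC (v t)) (v := id) hp hp7 hdvd
    (fun t σ => hΨ (v t) σ) (fun t => hC (v t)) hv0 hv1 hv2

/-- **`X_4 × X_p × X_{4p}` is not stably nondegenerate** — for three members of levels `4, p, 4p` (`p ≥ 7` prime) of ANY family (e.g. the
`J_m`-family, `4p ∣ m`). [cite: GalleseGoodsonLombardo2024, §1 (p. 4) and §3 Thm. 3.0] [cite: Gordon1999HodgeAVSurvey, 7.4, 7.5 and 7.6.1] -/
theorem not_isStablyNondegenerate_of_levels_fourMulPrime' {p : ℕ} (hp : p.Prime) (hp7 : 7 ≤ p)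
    (hΨ : ∀ j (σ : F j →+* ℂ), σ ∈ (Ψ j).1 ↔ 2 * (expOf (lev j) (F j) σ).val < lev j)
    (hC : ∀ j, IsCMTypeRealisation (Ψ j) (C j) (ιC j) (θC j)) {v : Fin 3 → κ} (hv0 : lev (v 0) = 4) (hv1 : lev (v 1) = p)
    (hv2 : lev (v 2) = 4 * p) : ¬IsStablyNondegenerate (⨁ fun t : Fin 3 => C (v t)) := by
  classical
  have h2 : ∀ j, 2 < lev j → IsCMField (F j) := fun j hj =>
    IsCyclotomicExtension.Rat.isCMField (F j) (S := {lev j}) ⟨lev j, rfl, hj⟩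
  haveI : ∀ t : Fin 3, IsCMField (F (v t)) := fun t => by
    fin_cases t
    · exact h2 (v 0) (by omega)
    · exact h2 (v 1) (by omega)
    · exact h2 (v 2) (by omega)
  obtain ⟨K₁, Φ₁, B, ιB, θB, hCM, hind, hB, hs, hniso, hsum, hrank⟩ :=
    exists_subpairs_of_levels_fourMulPrime' hp hp7 hΨ hC hv0 hv1 hv2
  haveI : ∀ t : Fin 3, IsCMField (K₁ t) := hCM
  rw [isStablyNondegenerate_biproduct_iff_cmFamilyRank_eq_sum_dim_inducedCMType hB hs hniso
    (fun t => algebraMap (K₁ t) (F (v t))) hind (fun t => hC (v t)), hrank, hsum]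
  omega

/-- **Every family with members of levels `4, p, 4p` (`p ≥ 7` prime) has a product of members carrying an exceptional Hodge class** — a
rational `(q,q)`-class outside `𝓓^q ⊗ ℂ` on some `⨁_{k<N} C_{π k}`. [cite: GalleseGoodsonLombardo2024, §1 (p. 4) and §3 Thm. 3.0 (3)–(5) with its last statement]
[cite: Gordon1999HodgeAVSurvey, 7.4, 7.5 and 7.6.1] [cite: Shimura1998, §6.2 Thm. 3 and §8.2 Prop. 26] -/
theorem exists_exceptional_prod_of_levels_fourMulPrime {p : ℕ} (hp : p.Prime) (hp7 : 7 ≤ p) (h₄ : ∃ j, lev j = 4)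
    (hP : ∃ j, lev j = p) (h₄P : ∃ j, lev j = 4 * p)
    (hΨ : ∀ j (σ : F j →+* ℂ), σ ∈ (Ψ j).1 ↔ 2 * (expOf (lev j) (F j) σ).val < lev j)
    (hC : ∀ j, IsCMTypeRealisation (Ψ j) (C j) (ιC j) (θC j)) :
    ∃ (N : ℕ) (π : Fin N → κ) (q : ℕ) (c : complexBetti (⨁ fun k : Fin N => C (π k)).X (2 * q)),
      IsRationalClass c ∧ IsOfHodgeType (⨁ fun k : Fin N => C (π k)).dim (⨁ fun k : Fin N => C (π k)).X (2 * q) q q c ∧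
      c ∉ divisorClassesSpan (⨁ fun k : Fin N => C (π k)).X (⨁ fun k : Fin N => C (π k)).dim q := by
  classical
  obtain ⟨j₄, hj₄⟩ := h₄
  obtain ⟨jP, hjP⟩ := hP
  obtain ⟨j₄P, hj₄P⟩ := h₄P
  let v : Fin 3 → κ := ![j₄, jP, j₄P]
  have hv0 : lev (v 0) = 4 := hj₄
  have hv1 : lev (v 1) = p := hjP
  have hv2 : lev (v 2) = 4 * p := hj₄P
  have h2 : ∀ j, 2 < lev j → IsCMField (F j) := fun j hj =>
    IsCyclotomicExtension.Rat.isCMField (F j) (S := {lev j}) ⟨lev j, rfl, hj⟩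
  haveI : ∀ t : Fin 3, IsCMField (F (v t)) := fun t => by
    fin_cases t
    · exact h2 (v 0) (by omega)
    · exact h2 (v 1) (by omega)
    · exact h2 (v 2) (by omega)
  obtain ⟨K₁, Φ₁, B, ιB, θB, hCM, hind, hB, hs, hniso, hsum, hrank⟩ :=
    exists_subpairs_of_levels_fourMulPrime' hp hp7 hΨ hC hv0 hv1 hv2
  haveI : ∀ t : Fin 3, IsCMField (K₁ t) := hCM
  have hsep : IsSeparatingFamily Φ₁ := isSeparatingFamily_of_isSimple_of_pairwise_not_isIsogenous hB hs hniso
  have hdeg : ∀ t, Module.finrank ℚ (K₁ t) = 2 * (B t).dim := fun t => finrank_eq_two_mul_dim_of_isCMTypeRealisation (hB t)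
  have hnot : ¬IsNondegenerateFamily Φ₁ := by
    rw [isNondegenerateFamily_iff_cmFamilyRank_inducedCMType (fun t => algebraMap (K₁ t) (F (v t))) Φ₁ hind, hrank,
      Finset.sum_congr rfl fun t _ => hdeg t, ← Finset.mul_sum, hsum]
    omega
  have hA' : ∀ t : Fin 3, IsCMTypeRealisation (inducedCMType (algebraMap (K₁ t) (F (v t))) (Φ₁ t)) (C (v t)) (ιC (v t)) (θC (v t)) :=
    fun t => by rw [hind t]; exact hC (v t)
  obtain ⟨N, π, q, c, hcQ, hcH, hcD⟩ :=
    exists_exceptional_prod_of_not_isNondegenerateFamily_inducedCMType (A := fun t : Fin 3 => C (v t)) hsep hnot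
      (fun t => algebraMap (K₁ t) (F (v t))) hA'
  exact ⟨N, fun k => v (π k), q, c, hcQ, hcH, hcD⟩

/-- **`J_m` IS STABLY DEGENERATE WHENEVER `4p ∣ m` FOR A PRIME `p ≥ 7`** (`m = 28, 44, 52, 56, 76, 84, 88, 92, …`): for the divisor family of `m`,
some product `⨁_{k<N} C_{π k}` of the CM pieces of `J_m` carries a rational `(q,q)`-class outside `𝓓^q ⊗ ℂ` (the pieces `X_4, X_p, X_{4p}` are among
them).  Nothing is claimed about the algebraicity of the class. [cite: GalleseGoodsonLombardo2024, §1 (p. 4: «in most cases the Hodge ring of J_m contains exceptional Hodge cycles») and §3 Thm. 3.0]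
[cite: Gordon1999HodgeAVSurvey, 7.4, 7.5 and 7.6.1] -/
theorem exists_exceptional_prod_of_fourMulPrime_dvd {p m : ℕ} (hp : p.Prime) (hp7 : 7 ≤ p) (hm : 4 * p ∣ m)
    (hlev : ∀ d, (∃ j, lev j = d) ↔ d ∣ m ∧ 3 ≤ d) (hΨ : ∀ j (σ : F j →+* ℂ), σ ∈ (Ψ j).1 ↔ 2 * (expOf (lev j) (F j) σ).val < lev j)
    (hC : ∀ j, IsCMTypeRealisation (Ψ j) (C j) (ιC j) (θC j)) :
    ∃ (N : ℕ) (π : Fin N → κ) (q : ℕ) (c : complexBetti (⨁ fun k : Fin N => C (π k)).X (2 * q)),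
      IsRationalClass c ∧ IsOfHodgeType (⨁ fun k : Fin N => C (π k)).dim (⨁ fun k : Fin N => C (π k)).X (2 * q) q q c ∧
      c ∉ divisorClassesSpan (⨁ fun k : Fin N => C (π k)).X (⨁ fun k : Fin N => C (π k)).dim q :=
  exists_exceptional_prod_of_levels_fourMulPrime hp hp7 ((hlev 4).2 ⟨dvd_trans (Dvd.intro p rfl) hm, by norm_num⟩)
    ((hlev p).2 ⟨dvd_trans (Dvd.intro_left 4 rfl) hm, by omega⟩) ((hlev (4 * p)).2 ⟨hm, by omega⟩) hΨ hC

/-! ## §5 `J_m` itself: the whole biproduct is not stably nondegenerate (Hazama's direct-factor remark, Gordon 7.6.1) -/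

/-- **`J_m` IS NOT STABLY NONDEGENERATE when its family has members of levels `4, p, 4p` (`p ≥ 7` prime)**: the sub-biproduct
`X_4 ⊕ X_p ⊕ X_{4p}` is a retract of `⨁_j C_j` (inclusion ∕ projection of summands), stable nondegeneracy descends along retracts (Hazama's
remark in Gordon 7.6.1, tree `IsStablyNondegenerate.of_comp_eq_nsmul_id`), and §4.  So some power of `⨁_j C_j` has Hodge ring NOT generated by
divisor classes. [cite: Gordon1999HodgeAVSurvey, 7.6.1 («if A is stably nondegenerate, and B is an abelian subvariety of A, then B is stably nondegenerate»), 7.4 and 7.5]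
[cite: GalleseGoodsonLombardo2024, §1 (p. 4) and §3 Thm. 3.0] -/
theorem not_isStablyNondegenerate_biproduct_of_levels_fourMulPrime [Fintype κ] [DecidableEq κ] {p : ℕ} (hp : p.Prime) (hp7 : 7 ≤ p)
    {j₄ jP j₄P : κ} (hj₄ : lev j₄ = 4) (hjP : lev jP = p) (hj₄P : lev j₄P = 4 * p)
    (hΨ : ∀ j (σ : F j →+* ℂ), σ ∈ (Ψ j).1 ↔ 2 * (expOf (lev j) (F j) σ).val < lev j)
    (hC : ∀ j, IsCMTypeRealisation (Ψ j) (C j) (ιC j) (θC j)) : ¬IsStablyNondegenerate (⨁ C) := by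
  classical
  let v : Fin 3 → κ := ![j₄, jP, j₄P]
  have hv0 : lev (v 0) = 4 := hj₄
  have hv1 : lev (v 1) = p := hjP
  have hv2 : lev (v 2) = 4 * p := hj₄P
  have hvinj : Function.Injective v := by
    intro a b hab
    have hl : lev (v a) = lev (v b) := congrArg lev hab
    fin_cases a <;> fin_cases b <;> first | rfl | (exfalso; simp [v] at hl; omega)
  -- the sub-biproduct over `v` is a retract of `⨁ C`
  let t : (⨁ fun a : Fin 3 => C (v a)) ⟶ ⨁ C := biproduct.desc fun a => biproduct.ι C (v a)
  let r : (⨁ C) ⟶ ⨁ fun a : Fin 3 => C (v a) := biproduct.lift fun a => biproduct.π C (v a)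
  have htr : t ≫ r = (1 : ℕ) • 𝟙 (⨁ fun a : Fin 3 => C (v a)) := by
    rw [one_smul]
    apply biproduct.hom_ext'
    intro a
    apply biproduct.hom_ext
    intro b
    simp only [t, r, Category.assoc, biproduct.ι_desc_assoc, biproduct.lift_π, Category.comp_id]
    by_cases hab : a = b
    · subst hab
      rw [biproduct.ι_π_self, biproduct.ι_π_self]
    · rw [biproduct.ι_π_ne _ (fun h => hab (hvinj h)), biproduct.ι_π_ne _ hab]
  intro hISN
  exact not_isStablyNondegenerate_of_levels_fourMulPrime' hp hp7 hΨ hC hv0 hv1 hv2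
    (HodgeTheory.IsStablyNondegenerate.of_comp_eq_nsmul_id t r one_ne_zero htr hISN)

/-- **`J_m` IS STABLY DEGENERATE FOR EVERY `m` WITH `4p ∣ m`, `p ≥ 7` PRIME** — the biproduct `⨁_j C_j` of the Thm.-3.0 decomposition of `J_m`
(and everything isogenous to it) is NOT stably nondegenerate: some power has a rational `(q,q)`-class outside the span of products of divisor
classes. [cite: GalleseGoodsonLombardo2024, §1 (p. 4: «in most cases the Hodge ring of J_m contains exceptional Hodge cycles») and §3 Thm. 3.0]
[cite: Gordon1999HodgeAVSurvey, 7.4, 7.5 and 7.6.1] -/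
theorem not_isStablyNondegenerate_of_isIsogenous_biproduct_of_fourMulPrime_dvd [Fintype κ] [DecidableEq κ] {p m : ℕ} (hp : p.Prime)
    (hp7 : 7 ≤ p) (hm : 4 * p ∣ m) (hlev : ∀ d, (∃ j, lev j = d) ↔ d ∣ m ∧ 3 ≤ d)
    (hΨ : ∀ j (σ : F j →+* ℂ), σ ∈ (Ψ j).1 ↔ 2 * (expOf (lev j) (F j) σ).val < lev j)
    (hC : ∀ j, IsCMTypeRealisation (Ψ j) (C j) (ιC j) (θC j)) {X : AbelianVariety ℂ} (hX : IsIsogenous X (⨁ C)) :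
    ¬IsStablyNondegenerate X := by
  obtain ⟨j₄, hj₄⟩ := (hlev 4).2 ⟨dvd_trans (Dvd.intro p rfl) hm, by norm_num⟩
  obtain ⟨jP, hjP⟩ := (hlev p).2 ⟨dvd_trans (Dvd.intro_left 4 rfl) hm, by omega⟩
  obtain ⟨j₄P, hj₄P⟩ := (hlev (4 * p)).2 ⟨hm, by omega⟩
  exact fun h => not_isStablyNondegenerate_biproduct_of_levels_fourMulPrime hp hp7 hj₄ hjP hj₄P hΨ hC (h.of_isIsogenous' hX)

end Family

end HyperellipticJacobian

end Literature.AlgebraicGeometry.ComplexMultiplication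

end
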